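import Literature.ModelTheory.ExponentialFields.ETheory
import Literature.ModelTheory.ExponentialFields.RestrictedExp
import HarnessLib

/-!
# `e` is definable from `exp↾[0,1]`: `L_e`-definable sets are `L_{exp↾}`-definable

Topic `Literature/ModelTheory/ExponentialFields`.  den Besten 2016, Lemma 6.2.3: the models of
`T_e` and `T_{exp↾}` (as reducts of models of `T_exp`) have the same definable sets, because
`e(x) = exp((1 + x²)⁻¹)` is existentially definable from `exp↾[0,1]`:
`y = e(x) ↔ ∃ u (u · (1 + x·x) = 1 ∧ y = exp↾(u))` (as `(1 + x²)⁻¹ ∈ (0, 1]`), and conversely.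
This light file (no o-minimality) provides the direction used downstream:

* `eOverRexpGraphFormula`, `eOverRexpDefs` — the definition of `{e}` over `L_{exp↾}`
  (`DefinitionalExpansion.lean` format), with `RealExpModel.eOverRexpDefs_isDefinedBy` (every
  model `K` of `T_exp`) and `Real.eOverRexpDefs_isDefinedBy` (`ℝ`);
* `orderedERingRexpHom : L_e →ᴸ L_{exp↾} ∪ {e}`;
* `RealExpModel.definable_orderedRexpRing_of_definable_orderedERing`,
  `Real.definable_orderedRexpRing_of_definable_orderedERing`.

Consumers: `ERestricted.lean` (o-minimality of `K | L_e` and `k | L_e ≼ K | L_e` from the First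
Main Theorem).  Nothing here is a named fact.

## References

* M. den Besten, MSc thesis, Utrecht 2016, Lemma 6.2.3. [DenBesten2016]
-/

noncomputable section

open FirstOrder FirstOrder.Language FirstOrder.Language.Structure
open scoped FirstOrder

namespace Literature.ModelTheory.ExponentialFields

universe w

/-! ### The definition of `e` over `L_{exp↾}` -/

/-- The `L_{exp↾}`-formula `∃ u (u · (1 + x·x) = 1 ∧ y = exp↾(u))` in the variables `(y, x)`
defining the graph of `e` (den Besten 2016, proof of Lemma 6.2.3). [cite: DenBesten2016, Lemma 6.2.3] -/
def eOverRexpGraphFormula : Language.orderedRexpRing.Formula (Fin 2) :=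
  let tL : Language.orderedRing.Term (Fin 2 ⊕ Unit) :=
    var (Sum.inr ()) * (1 + var (Sum.inl 1) * var (Sum.inl 1))
  Formula.iExs Unit
    ((Term.equal (LHom.sumInl.onTerm tL) (LHom.sumInl.onTerm (1 : Language.orderedRing.Term _))) ⊓
      (Term.equal (var (Sum.inl 0))
        ((LHom.sumInr : Language.rexpUnary →ᴸ Language.orderedRexpRing).onTerm
          (Functions.apply₁ rexpFunc.rexp (var (Sum.inr ()))))))

/-- **The definition of `{e}` over `L_{exp↾}`**: `e` by `eOverRexpGraphFormula`.
[cite: DenBesten2016, Lemma 6.2.3] -/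
def eOverRexpDefs : Definitions Language.orderedRexpRing Language.eUnary where
  δ := fun {k} g =>
    match k, g with
    | _, eFunc.e => eOverRexpGraphFormula
  ρ := fun r => r.elim

namespace RealExpModel

variable {K : Language.Theory.ModelType.{0, 0, w} realExpTheory}

/-- On a solution `u` of `u · (1 + a·a) = 1` the restricted exponential is the exponential
(`0 ≤ u ≤ 1`). [folklore] -/
theorem rexp_eq_exp_of_mul_eq_one {a u : K} (h : u * (1 + a * a) = 1) :
    RexpFun.rexp u = exp u := by
  have hpos : (0 : K) < 1 + a * a := add_pos_of_pos_of_nonneg one_pos (mul_self_nonneg _)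
  have hu : u = (1 + a * a)⁻¹ := eq_inv_of_mul_eq_one_left h
  have h0 : 0 ≤ u := by rw [hu]; exact (inv_pos.2 hpos).le
  have h1 : u ≤ 1 := by
    rw [hu]
    exact inv_le_one_of_one_le₀ (le_add_of_nonneg_right (mul_self_nonneg a))
  rw [rexp_def, if_pos ⟨h0, h1⟩]

variable (K)

/-- **A model `K` of `T_exp` with `e` and `exp↾` is, as an `L_{exp↾} ∪ {e}`-structure, the
definitional expansion of `K | L_{exp↾}` along `eOverRexpDefs`** (den Besten 2016, proof of
Lemma 6.2.3). [cite: DenBesten2016, Lemma 6.2.3] -/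
theorem eOverRexpDefs_isDefinedBy : eOverRexpDefs.IsDefinedBy K where
  realize_δ_iff := by
    intro k g x y
    cases g
    have ha : (1 : K) + x 0 * x 0 ≠ 0 := (add_pos_of_pos_of_nonneg one_pos (mul_self_nonneg _)).ne'
    simp only [eOverRexpDefs, eOverRexpGraphFormula, Formula.realize_iExs, Formula.realize_inf,
      Formula.realize_equal, LHom.realize_onTerm, Language.orderedRing.realize_mul,
      Language.orderedRing.realize_add, Language.orderedRing.realize_one, Term.realize_var,
      Sum.elim_inr, Sum.elim_inl, Fin.cons_one, Fin.cons_zero, Term.realize_functions_apply₁,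
      Language.rexpUnary.funMap_rexp, Language.eUnary.funMap_e, Matrix.cons_val_zero]
    rw [exists_unit_fun_iff (P := fun u => u * (1 + x 0 * x 0) = 1 ∧ y = RexpFun.rexp u), e_def,
      ← exists_mul_one_add_mul_self_eq_one_iff exp ha]
    constructor
    · rintro ⟨u, hu, rfl⟩
      exact ⟨u, hu, rexp_eq_exp_of_mul_eq_one hu⟩
    · rintro ⟨u, hu, rfl⟩
      exact ⟨u, hu, (rexp_eq_exp_of_mul_eq_one hu).symm⟩
  realize_ρ_iff := by
    intro k r
    exact r.elim

end RealExpModel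

/-- On `ℝ`: a solution `u` of `u · (1 + a·a) = 1` lies in `[0, 1]`, so `exp↾ u = exp u`. [folklore] -/
theorem Real.rexp_eq_exp_of_mul_eq_one {a u : ℝ} (h : u * (1 + a * a) = 1) :
    RexpFun.rexp u = Real.exp u := by
  have hpos : (0 : ℝ) < 1 + a * a := add_pos_of_pos_of_nonneg one_pos (mul_self_nonneg _)
  have hu : u = (1 + a * a)⁻¹ := eq_inv_of_mul_eq_one_left h
  have h0 : 0 ≤ u := by rw [hu]; exact (inv_pos.2 hpos).le
  have h1 : u ≤ 1 := by
    rw [hu]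
    exact inv_le_one_of_one_le₀ (le_add_of_nonneg_right (mul_self_nonneg a))
  rw [Real.rexp_def, if_pos ⟨h0, h1⟩]

/-- **`ℝ` with `e` and `exp↾` (its own structures) is the definitional expansion of
`(ℝ; exp↾)` along `eOverRexpDefs`.** [cite: DenBesten2016, Lemma 6.2.3] -/
theorem Real.eOverRexpDefs_isDefinedBy : eOverRexpDefs.IsDefinedBy ℝ where
  realize_δ_iff := by
    intro k g x y
    cases g
    have ha : (1 : ℝ) + x 0 * x 0 ≠ 0 := (add_pos_of_pos_of_nonneg one_pos (mul_self_nonneg _)).ne'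
    simp only [eOverRexpDefs, eOverRexpGraphFormula, Formula.realize_iExs, Formula.realize_inf,
      Formula.realize_equal, LHom.realize_onTerm, Language.orderedRing.realize_mul,
      Language.orderedRing.realize_add, Language.orderedRing.realize_one, Term.realize_var,
      Sum.elim_inr, Sum.elim_inl, Fin.cons_one, Fin.cons_zero, Term.realize_functions_apply₁,
      Language.rexpUnary.funMap_rexp, Language.eUnary.funMap_e, Matrix.cons_val_zero]
    rw [exists_unit_fun_iff (P := fun u => u * (1 + x 0 * x 0) = 1 ∧ y = RexpFun.rexp u),
      Real.e_def, ← exists_mul_one_add_mul_self_eq_one_iff Real.exp ha]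
    constructor
    · rintro ⟨u, hu, rfl⟩
      exact ⟨u, hu, Real.rexp_eq_exp_of_mul_eq_one hu⟩
    · rintro ⟨u, hu, rfl⟩
      exact ⟨u, hu, (Real.rexp_eq_exp_of_mul_eq_one hu).symm⟩
  realize_ρ_iff := by
    intro k r
    exact r.elim

/-- The inclusion `L_e → L_{exp↾} ∪ {e}` (ordered-ring symbols to the left summand, `e` to the
right). [folklore] -/
abbrev orderedERingRexpHom :
    Language.orderedERing →ᴸ Language.orderedRexpRing.sum Language.eUnary :=
  (LHom.sumInl : Language.orderedRing →ᴸ Language.orderedRexpRing).sumMap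
    (LHom.id Language.eUnary)

namespace RealExpModel

/-- **`L_e`-definable sets of a model of `T_exp` are `L_{exp↾}`-definable** (same parameters;
den Besten 2016, Lemma 6.2.3: "the same definable sets"). [cite: DenBesten2016, Lemma 6.2.3] -/
theorem definable_orderedRexpRing_of_definable_orderedERing
    (K : Language.Theory.ModelType.{0, 0, w} realExpTheory) {A : Set K} {α : Type*}
    {s : Set (α → K)} (h : A.Definable Language.orderedERing s) :
    A.Definable Language.orderedRexpRing s :=
  (eOverRexpDefs_isDefinedBy K).definable_of_definable_sum (h.map_expansion orderedERingRexpHom)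

/-- `L_e`-definable subsets of `ℝⁿ` are `L_{exp↾}`-definable (same parameters). [cite: DenBesten2016, Lemma 6.2.3] -/
theorem _root_.Literature.ModelTheory.ExponentialFields.Real.definable_orderedRexpRing_of_definable_orderedERing
    {A : Set ℝ} {α : Type*} {s : Set (α → ℝ)} (h : A.Definable Language.orderedERing s) :
    A.Definable Language.orderedRexpRing s :=
  Real.eOverRexpDefs_isDefinedBy.definable_of_definable_sum (h.map_expansion orderedERingRexpHom)

end RealExpModel

end Literature.ModelTheory.ExponentialFields
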